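import Mathlib
import HarnessLib
import Literature.Analysis.FluidPDE.VorticityBlowupMaximal
import Summits.NavierStokesRegularity.NavierStokesRegularity.Theorems.HalfSpaceWindowDoorCirculationCarryingRigidityAxisCirculation
import Summits.NavierStokesRegularity.NavierStokesRegularity.Theorems.AxisTwistDoorAveragedConeLiouvilleCircleCalculus

/-!
# Route `HalfSpaceWindowDoor`, crux `CirculationCarryingRigidity` (stmt-NavierStokesRegularity-25311) — the AXIS CIRCULATION
# of a door-class profile: LRT's circle law `∂ₛΓ = Γ_rr − r⁻¹Γ_r + Γ_zz − ∮(v_r ω₃ − ω_r v₃) dl`, the size of the circle term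
# under the circle-averaged cone, and its joint continuity (dynamics for the sourced swirl Liouville tool)

For a profile `v` of the door's Type-I ancient Oseen-mild class (jointly smooth on the open slab): (i) AxisTwistDoor's
circle-averaged swirl law (`…CircleSwirl.circleSwirlEquation_of_classical`, via the classical pressure of the class) in LRT's
form `∂ₛΓ = Γ_rr − r⁻¹Γ_r + Γ_zz − T`, `T = circleTerm = ∮(v_r ω₃ − ω_r v₃) dl` (`deriv_circ_s_eq`); (ii) under the sign
`ω₃ ≥ 0` and a velocity bound `B` on the circle, `|T| ≤ B(∮ω₃ dl + ∮|ω_h| dl)` (the tree's `abs_circleTerm_le` for the door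
class), hence `|T| ≤ (1+K) B ∮ω₃ dl` under the circle-averaged cone `∮|ω_h| dl ≤ K ∮ω₃ dl`; (iii) `T` and `∮ω₃ dl` are jointly
continuous in `(r,z,s)` on `s < 0`.  With `B = D/(r + √(−s))` (space–time Type I) this makes `T = β ∂ᵣΓ` an admissible extra
radial drift of the sourced swirl tool (`|β| r, |β|√(−s) ≤ (1+K)D`).

Seat ns-hsw-p1 g3 (LEAD of 25311, cell pub-ns-dss).  WHAT THIS IS NOT: not a statement about Navier–Stokes regularity;
calculus for HYPOTHETICAL blow-up profiles; helper `--supports` 25311.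
-/

noncomputable section

-- the summit and its single sub-problem share the name (CONVENTIONS §1), as in every Theorems file
set_option linter.dupNamespace false

namespace Summit.NavierStokesRegularity.NavierStokesRegularity.Theorems.HalfSpaceWindowDoorCirculationCarryingRigidityAxisCirculationDynamics

open MeasureTheory Set Function Filter Topology TopologicalSpace InnerProductSpace WithLp Metric
open scoped Laplacian RealInnerProductSpace ContDiff
open Literature.Analysis Literature.Analysis.FluidPDE
open Summit.NavierStokesRegularity.NavierStokesRegularity.Theorems.AxisTwistDoorAveragedConeLiouvilleDefs
  (cylPt eT e3 circ vortCirc radVortCirc tiltCirc meanR meanZ remainder circleTerm CircleSwirlEquation SignE3 GlobalCone)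
open Summit.NavierStokesRegularity.NavierStokesRegularity.Theorems.AveragedConeLiouville.CircleStokes
  (deriv_circ_eq_vortCirc continuous_eR)
open Summit.NavierStokesRegularity.NavierStokesRegularity.Theorems.AveragedConeLiouville.CircleCalculus (deriv_circ_z)
open Summit.NavierStokesRegularity.NavierStokesRegularity.Theorems.AveragedConeLiouville.CircMonotone
  (circ_zero vortCirc_zero tiltCirc_zero vortCirc_nonneg)
open Summit.NavierStokesRegularity.NavierStokesRegularity.Theorems.AveragedConeLiouville.CircleSwirl
  (circleTerm_eq circleSwirlEquation_of_classical)
open Summit.NavierStokesRegularity.NavierStokesRegularity.Theorems.AxisTwistDoorAveragedConeLiouvilleCylFrame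
  (abs_circleTerm_integrand_le continuous_horizontal abs_integral_le_const_mul_add contDiff_cylPt_comp continuous_cylPt_θ)
open Summit.NavierStokesRegularity.NavierStokesRegularity.Theorems.PoloidalWindowDoorPoloidalWindowRigidityWindow
  (isTypeIAncientMild_of_class)
open Summit.NavierStokesRegularity.NavierStokesRegularity.Theorems.HalfSpaceWindowDoorCirculationCarryingRigidityAxisCirculation

-- AxisTwistDoor's angular radial unit vector `e_r(θ)` is its `…Defs.eR`; renamed on opening to avoid the clash with the radial
-- unit vector FIELD `Literature.Analysis.FluidPDE.eR`
open Summit.NavierStokesRegularity.NavierStokesRegularity.Theorems.AxisTwistDoorAveragedConeLiouvilleDefs renaming eR → eRang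

variable {C D : ℝ} {v : ℝ → EuclideanSpace ℝ (Fin 3) → EuclideanSpace ℝ (Fin 3)}

/-! ### Joint continuity of the circle functionals -/

/-- A parametric interval integral of an integrand continuous on `ℝ × U` is continuous on `U`. -/
theorem continuousOn_parametric_integral {P : Type*} [TopologicalSpace P] {g : ℝ → P → ℝ} {U : Set P}
    (hg : ContinuousOn (fun w : ℝ × P => g w.1 w.2) (univ ×ˢ U)) (a b : ℝ) :
    ContinuousOn (fun p => ∫ θ in a..b, g θ p) U := by
  rw [continuousOn_iff_continuous_restrict]
  have hH : Continuous (uncurry fun (q : U) (θ : ℝ) => g θ q.1) := by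
    have hmap : Continuous fun z : U × ℝ => ((z.2, (z.1 : P)) : ℝ × P) := by fun_prop
    have hmaps : ∀ z : U × ℝ, ((z.2, (z.1 : P)) : ℝ × P) ∈ univ ×ˢ U := fun z => ⟨mem_univ _, z.1.2⟩
    exact hg.comp_continuous hmap hmaps
  exact intervalIntegral.continuous_parametric_intervalIntegral_of_continuous' hH a b

/-- `(θ, (r, z, s)) ↦ v(s)(cylPt r θ z)` is continuous on `ℝ × {s < 0}` for a field jointly smooth on the open slab. -/
theorem continuousOn_slice_cylPt (hv : IsSmoothSpaceTimeOn (Iio (0 : ℝ)) v) :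
    ContinuousOn (fun w : ℝ × (ℝ × ℝ × ℝ) => v w.2.2.2 (cylPt w.2.1 w.1 w.2.2.1)) (univ ×ˢ {q | q.2.2 < 0}) := by
  have hc : Continuous fun w : ℝ × (ℝ × ℝ × ℝ) => ((w.2.2.2, cylPt w.2.1 w.1 w.2.2.1) : ℝ × EuclideanSpace ℝ (Fin 3)) :=
    (continuous_snd.comp (continuous_snd.comp continuous_snd)).prodMk
      (contDiff_cylPt_comp (n := 0) (contDiff_fst.comp contDiff_snd) contDiff_fst
        (contDiff_fst.comp (contDiff_snd.comp contDiff_snd))).continuous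
  have hmaps : MapsTo (fun w : ℝ × (ℝ × ℝ × ℝ) => ((w.2.2.2, cylPt w.2.1 w.1 w.2.2.1) : ℝ × EuclideanSpace ℝ (Fin 3)))
      (univ ×ˢ {q | q.2.2 < 0}) (Iio (0 : ℝ) ×ˢ univ) := fun w hw => ⟨hw.2, mem_univ _⟩
  exact hv.continuousOn.comp hc.continuousOn hmaps

/-- `(θ, (r, z, s)) ↦ curl v(s) (cylPt r θ z)` is continuous on `ℝ × {s < 0}`. -/
theorem continuousOn_curl_cylPt (hv : IsSmoothSpaceTimeOn (Iio (0 : ℝ)) v) :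
    ContinuousOn (fun w : ℝ × (ℝ × ℝ × ℝ) => curl (v w.2.2.2) (cylPt w.2.1 w.1 w.2.2.1)) (univ ×ˢ {q | q.2.2 < 0}) := by
  have hc : Continuous fun w : ℝ × (ℝ × ℝ × ℝ) => ((w.2.2.2, cylPt w.2.1 w.1 w.2.2.1) : ℝ × EuclideanSpace ℝ (Fin 3)) :=
    (continuous_snd.comp (continuous_snd.comp continuous_snd)).prodMk
      (contDiff_cylPt_comp (n := 0) (contDiff_fst.comp contDiff_snd) contDiff_fst
        (contDiff_fst.comp (contDiff_snd.comp contDiff_snd))).continuous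
  have hmaps : MapsTo (fun w : ℝ × (ℝ × ℝ × ℝ) => ((w.2.2.2, cylPt w.2.1 w.1 w.2.2.1) : ℝ × EuclideanSpace ℝ (Fin 3)))
      (univ ×ˢ {q | q.2.2 < 0}) (Iio (0 : ℝ) ×ˢ univ) := fun w hw => ⟨hw.2, mem_univ _⟩
  exact (hv.continuousOn_curl (uniqueDiffOn_Iio 0)).comp hc.continuousOn hmaps

/-- **Joint continuity of `∮ω₃ dl`** in `(r, z, s)` on `s < 0`. -/
theorem continuousOn_vortCirc (hv : IsSmoothSpaceTimeOn (Iio (0 : ℝ)) v) :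
    ContinuousOn (fun q : ℝ × ℝ × ℝ => vortCirc v q.1 q.2.1 q.2.2) {q | q.2.2 < 0} := by
  have hg : ContinuousOn (fun w : ℝ × (ℝ × ℝ × ℝ) =>
      ⟪curl (v w.2.2.2) (cylPt w.2.1 w.1 w.2.2.1), e3⟫_ℝ * w.2.1) (univ ×ˢ {q | q.2.2 < 0}) :=
    ((continuousOn_curl_cylPt hv).inner continuousOn_const).mul (continuous_fst.comp continuous_snd).continuousOn
  exact continuousOn_parametric_integral hg 0 (2 * Real.pi)

/-- **Joint continuity of LRT's circle term** `∮(v_r ω₃ − ω_r v₃) dl` in `(r, z, s)` on `s < 0`. -/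
theorem continuousOn_circleTerm (hv : IsSmoothSpaceTimeOn (Iio (0 : ℝ)) v) :
    ContinuousOn (fun q : ℝ × ℝ × ℝ => circleTerm v q.1 q.2.1 q.2.2) {q | q.2.2 < 0} := by
  have hV := continuousOn_slice_cylPt hv
  have hW := continuousOn_curl_cylPt hv
  have heR : Continuous fun w : ℝ × (ℝ × ℝ × ℝ) => eRang w.1 := continuous_eR.comp continuous_fst
  have hg : ContinuousOn (fun w : ℝ × (ℝ × ℝ × ℝ) =>
      (⟪v w.2.2.2 (cylPt w.2.1 w.1 w.2.2.1), eRang w.1⟫_ℝ * ⟪curl (v w.2.2.2) (cylPt w.2.1 w.1 w.2.2.1), e3⟫_ℝ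
        - ⟪curl (v w.2.2.2) (cylPt w.2.1 w.1 w.2.2.1), eRang w.1⟫_ℝ * ⟪v w.2.2.2 (cylPt w.2.1 w.1 w.2.2.1), e3⟫_ℝ)
        * w.2.1) (univ ×ˢ {q | q.2.2 < 0}) :=
    (((hV.inner heR.continuousOn).mul (hW.inner continuousOn_const)).sub
      ((hW.inner heR.continuousOn).mul (hV.inner continuousOn_const))).mul
      (continuous_fst.comp continuous_snd).continuousOn
  exact continuousOn_parametric_integral hg 0 (2 * Real.pi)

/-! ### The size of the circle term under the sign and the circle-averaged cone -/

/-- **`|∮(v_r ω₃ − ω_r v₃) dl| ≤ B (∮ω₃ dl + ∮|ω_h| dl)`** for a `C¹` slice with `ω₃ ≥ 0` and `‖v(s)‖ ≤ B` on the circle (the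
tree's `…CircleToolkit.abs_circleTerm_le`, for any smooth slice). -/
theorem abs_circleTerm_le {s r z B : ℝ} (hv : ContDiff ℝ 1 (v s)) (hsign : ∀ y, 0 ≤ ⟪curl (v s) y, e3⟫_ℝ)
    (hr : 0 ≤ r) (hB : ∀ θ : ℝ, ‖v s (cylPt r θ z)‖ ≤ B) :
    |circleTerm v r z s| ≤ B * (vortCirc v r z s + tiltCirc v r z s) := by
  have hvc : Continuous fun θ => v s (cylPt r θ z) := hv.continuous.comp (continuous_cylPt_θ r z)
  have hωc : Continuous fun θ => curl (v s) (cylPt r θ z) := by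
    have hD : Continuous (fderiv ℝ (v s)) := hv.continuous_fderiv one_ne_zero
    have e : curl (v s) = fun x => curlCLM (fderiv ℝ (v s) x) := by funext x; exact curl_eq_curlCLM (v s) x
    rw [e]
    exact (curlCLM.continuous.comp hD).comp (continuous_cylPt_θ r z)
  have hf : Continuous fun θ => (⟪v s (cylPt r θ z), eRang θ⟫_ℝ * ⟪curl (v s) (cylPt r θ z), e3⟫_ℝ
      - ⟪curl (v s) (cylPt r θ z), eRang θ⟫_ℝ * ⟪v s (cylPt r θ z), e3⟫_ℝ) * r :=
    (((hvc.inner continuous_eR).mul (hωc.inner continuous_const)).sub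
      ((hωc.inner continuous_eR).mul (hvc.inner continuous_const))).mul continuous_const
  have hg1 : Continuous fun θ => ⟪curl (v s) (cylPt r θ z), e3⟫_ℝ * r :=
    (hωc.inner continuous_const).mul continuous_const
  have hg2 : Continuous fun θ => ‖curl (v s) (cylPt r θ z) - ⟪curl (v s) (cylPt r θ z), e3⟫_ℝ • e3‖ * r :=
    ((continuous_horizontal.comp hωc).norm).mul continuous_const
  exact abs_integral_le_const_mul_add hf hg1 hg2 fun θ =>
    abs_circleTerm_integrand_le (v s (cylPt r θ z)) (curl (v s) (cylPt r θ z)) hr (hB θ) (hsign (cylPt r θ z))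

/-- **Under the circle-averaged cone `∮|ω_h| dl ≤ K ∮ω₃ dl` the circle term is a multiple of the vertical flux**:
`|T| ≤ (1+K) B ∮ω₃ dl`. -/
theorem abs_circleTerm_le_cone {s r z B K : ℝ} (hv : ContDiff ℝ 1 (v s)) (hsign : ∀ y, 0 ≤ ⟪curl (v s) y, e3⟫_ℝ)
    (hr : 0 ≤ r) (hB : ∀ θ : ℝ, ‖v s (cylPt r θ z)‖ ≤ B) (hB0 : 0 ≤ B)
    (hcone : tiltCirc v r z s ≤ K * vortCirc v r z s) :
    |circleTerm v r z s| ≤ (1 + K) * B * vortCirc v r z s := by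
  have h := abs_circleTerm_le hv hsign hr hB
  have h2 : B * (vortCirc v r z s + tiltCirc v r z s) ≤ (1 + K) * B * vortCirc v r z s := by
    have := mul_le_mul_of_nonneg_left (add_le_add_left hcone (vortCirc v r z s)) hB0
    linarith
  exact h.trans h2

/-- On an axis circle of a GLOBALLY coned profile (`GlobalCone`, all circles about the axis) the tilt is dominated also at
`r = 0` (both sides vanish). -/
theorem tiltCirc_le_of_globalCone (hcone : GlobalCone v) :
    ∃ K : ℝ, 0 ≤ K ∧ ∀ s < 0, ∀ r : ℝ, 0 ≤ r → ∀ z : ℝ, tiltCirc v r z s ≤ K * vortCirc v r z s := by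
  obtain ⟨K, hK0, hK⟩ := hcone
  refine ⟨K, hK0, fun s hs r hr z => ?_⟩
  rcases hr.eq_or_lt with h | h
  · rw [← h, tiltCirc_zero, vortCirc_zero, mul_zero]
  · exact hK s hs r h z

/-! ### LRT's circle law for the axis circulation of a door-class profile -/

/-- **`∂ₛΓ = Γ_rr − r⁻¹ Γ_r + Γ_zz − ∮(v_r ω₃ − ω_r v₃) dl`** off the axis at every `s < 0`, for a profile of the door's Type-I
ancient Oseen-mild class (AxisTwistDoor's circle-averaged swirl law `CircleSwirlEquation` for the classical solution of the
class, Stokes `Γ_r = ∮ω₃`, `Γ_z = −∮ω_r`, and `circleTerm_eq`). -/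
theorem deriv_circ_s_eq (hrate : HasTypeITimeDecay C v)
    (hcont : ContinuousOn (uncurry v) (Iio (0 : ℝ) ×ˢ univ))
    (hmild : ∀ s t : ℝ, s < t → t < 0 → ∀ x,
      v t x = UnboundedOperators.heatExtension (v s) (t - s) x - oseenDuhamel 1 s v v t x)
    (hdiv : ∀ t < 0, VectorCalculus.IsDivFree (v t)) {s : ℝ} (hs : s < 0) {r : ℝ} (hr : 0 < r) (z : ℝ) :
    deriv (fun s' => circ v r z s') s =
      deriv (fun r' => deriv (fun r'' => circ v r'' z s) r') r - r⁻¹ * deriv (fun r' => circ v r' z s) r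
        + deriv (fun z' => deriv (fun z'' => circ v r z'' s) z') z - circleTerm v r z s := by
  have hA := isTypeIAncientMild_of_class hrate hcont hmild hdiv
  obtain ⟨p, hcl⟩ := exists_isClassicalNSSolutionOn_Iio_of_isTypeIAncientMild hA
  obtain ⟨hdr, hcse⟩ := circleSwirlEquation_of_classical hcl s hs r hr z
  have hC1 : ContDiff ℝ 1 (v s) := (IsSmoothSpaceTimeOn.contDiff_slice hA.contDiffOn hs).of_le (by norm_cast)
  have hdz : deriv (fun z' => circ v r z' s) z = -radVortCirc v r z s := deriv_circ_z v hC1 r z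
  have hT := circleTerm_eq v hC1 r z
  rw [hdr] at hcse
  rw [hdz] at hcse
  rw [hdr]
  linarith [hcse, hT]

end Summit.NavierStokesRegularity.NavierStokesRegularity.Theorems.HalfSpaceWindowDoorCirculationCarryingRigidityAxisCirculationDynamics

end
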